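import Literature.AnabelianGeometry.EtaleTheta.FrobenioidThetaDivisorSupportQAdjacency
import Literature.AnabelianGeometry.EtaleTheta.FrobenioidThetaDivisorSupportQTransport
import Literature.AnabelianGeometry.EtaleTheta.FrobenioidThetaDivisorSupportAutChain

/-!
# [EtTh] §5, Proposition 5.3 (i)–(vi) over PERFECT `Φ(A_⊚)`, modulo the structural binders only (repair `Q`, part 6: assembly)

Mochizuki, *The étale theta function …*, Publ. RIMS **45** (2009)
[cite: MochizukiEtTh2009, Prop 5.3 p.325–326 (PDF pp.99–100); proof p.326–327 (PDF pp.100–101); Prop 1.4 (i) p.247 (PDF p.21); §1 p.238–240 (PDF pp.12–14)].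
Seat abc-iut-L6-d1 (gen 4); proof-only port of abc-iut-L2-d4's assembly (`Discharge/Sec5Prop53LabelsR.lean` §Prop53R,
`Discharge/Sec5Prop53ThetaOrbit.lean`, p424618/p426802) and of this lineage's `…SupportAutChain.lean` (p440609) — all over
the `ℤ`-reading `DivisorSupportData'`, vacuous at perfect `Φ(A_⊚)` by p436191 — to the perfect-`Φ` repair
`DivisorSupportDataQ` (p441752).  Reused BY NAME: abc-iut-L2-t4-lineage's `preservesNcspLabels_of_adjacency` /
`int_equiv_affine_of_adjacency`, L2-d4's `DivisorPrimeData.isCuspidal_congr_symm_iff` / `ncspEquivZ_congr_symm`, this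
lineage's `DivisorPrimeData.ncspLabels_affine_of_adjacency`.

WHAT IS PROVED, for `ψ = Ψ^Φ_{A_⊚}` (and for every `pullAut g`, `g ∈ Aut_C(A_⊚)`) under F1-`ψ` (`hP`, `iff` form),
Prop. 5.3 (i) on primes (`hc`) and the integral intersection-theory binder `hInt` (`PrincipalIffIntegralDegreeZero`):
(ii)/(iii) `preserves{N,C}spComponentIsos_of_principalQ` (from `map_ncspIso`/`map_cspIso`: NON-VACUOUS replacements of
the instance forms of record `…_of_monoidTypeZ`, whose hypothesis `hN` is unsatisfiable at perfect `Φ`, F-0559/F-0562);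
(iv) `preservesCspToNcsp_of_principalQ`; (v) `preservesNcspLabels_of_principalQ` (adjacency criterion ⇐ `hInt`,
transported by `ψ`, rigidity of the chain); the binder (hAut) of (vi) as a THEOREM `autChain_of_principalQ` from cusp-Aut
+ F1-Aut + `hInt`; (vi) `preservesThetaDivisorOrbit_of_principalQ` from the profile of `div(Θ̈)` (`hdiv`, Prop. 1.4 (i));
and the six-part `geometryOfDivisorsPreserved_of_principalQ` MODULO {`hind` ([FrdI] Thm. 4.9), (i) as typed (Cor. 3.8
(iii)), F1-Ψ, F1-Aut, cusp-Aut, hInt, hdiv}.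
HONEST FRAMING: implications between predicates on OUR typed data; none of the binders is discharged here (owner: the
genuine special fibre of `Ÿ`); typed ≠ proved for the genuine curve; no side taken on anything downstream; nothing here
lies inside the [IUTchIII] Cor. 3.12 cone. -/

namespace Literature.AnabelianGeometry.EtaleTheta

open CategoryTheory
open Literature.AlgebraicGeometry.Frobenioids

universe w v v' u u'

namespace FrobenioidThetaDivisors

open scoped Classical

variable {C : Type u} [Category.{v} C] {D : Type u'} [Category.{v'} D] {𝔉 : ThetaFrobenioid.{w} C D}
variable {𝔓 : DivisorPrimeData 𝔉}

namespace DivisorSupportDataQ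

variable (ψ : 𝔉.PhiAcirc ≃* 𝔉.PhiAcirc)

/-! ### Adjacency and labels, for an arbitrary `ψ` preserving cusps and principal elements -/

/-- **Adjacency of components is preserved** by ANY monoid automorphism `ψ` of `Φ(A_⊚)` preserving the cuspidal primes
and the principal elements, under the integral binder (criterion of (v) ⇐ `hInt`; transported along `ψ^gp`; `ψ` maps
`gen 𝔭 ↦ gen ψ𝔭` and commutes with the pinned isomorphism of (ii)).
[cite: MochizukiEtTh2009, Prop 5.3 proof p.327 (PDF p.101)] -/
theorem abs_sub_eq_one_congr_of_principalQ (𝔖 : DivisorSupportDataQ 𝔓) (hI : 𝔖.PrincipalIffIntegralDegreeZero)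
    (hc : ∀ 𝔭, 𝔓.IsCuspidal (Primes.congr ψ 𝔭) ↔ 𝔓.IsCuspidal 𝔭)
    (hP : ∀ x, ThetaFrobenioid.gpMap ψ.toMonoidHom x ∈ 𝔖.principal ↔ x ∈ 𝔖.principal)
    (𝔭 𝔮 : Primes 𝔉.PhiAcirc) (h𝔭 : ¬ 𝔓.IsCuspidal 𝔭) (h𝔮 : ¬ 𝔓.IsCuspidal 𝔮)
    (hadj : |𝔓.ncspEquivZ ⟨𝔭, h𝔭⟩ - 𝔓.ncspEquivZ ⟨𝔮, h𝔮⟩| = 1) :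
    |𝔓.ncspEquivZ ⟨Primes.congr ψ 𝔭, fun h => h𝔭 ((hc 𝔭).mp h)⟩ -
        𝔓.ncspEquivZ ⟨Primes.congr ψ 𝔮, fun h => h𝔮 ((hc 𝔮).mp h)⟩| = 1 := by
  have hAdj := 𝔖.adjacencyCriterionQ_of_principalIffIntegralDegreeZero hI
  have hne : 𝔭 ≠ 𝔮 := by
    rintro rfl
    rw [sub_self, abs_zero] at hadj
    exact zero_ne_one hadj
  have h𝔭' : ¬ 𝔓.IsCuspidal (Primes.congr ψ 𝔭) := fun h => h𝔭 ((hc 𝔭).mp h)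
  have h𝔮' : ¬ 𝔓.IsCuspidal (Primes.congr ψ 𝔮) := fun h => h𝔮 ((hc 𝔮).mp h)
  have hne' : Primes.congr ψ 𝔭 ≠ Primes.congr ψ 𝔮 := fun h => hne ((Primes.congr ψ).injective h)
  let a : 𝔭.submonoid := ⟨𝔖.gen 𝔭, 𝔖.gen_mem_submonoid 𝔭⟩
  have ha : (a : 𝔉.PhiAcirc) = 𝔖.gen 𝔭 ^ 1 := (pow_one _).symm
  have H4 := (hAdj 𝔭 𝔮 h𝔭 h𝔮 hne 1 one_pos a ha).1.mp hadj
  let a' : (Primes.congr ψ 𝔭).submonoid := Primes.submonoidCongr ψ 𝔭 _ rfl a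
  have ha' : (a' : 𝔉.PhiAcirc) = 𝔖.gen (Primes.congr ψ 𝔭) ^ 1 := by
    rw [Primes.coe_submonoidCongr_apply, pow_one]; exact 𝔖.map_gen_of_principal ψ hI hP 𝔭
  have hb' : (𝔓.ncspIso _ _ h𝔭' h𝔮' a' : 𝔉.PhiAcirc) = ψ (𝔓.ncspIso 𝔭 𝔮 h𝔭 h𝔮 a : 𝔉.PhiAcirc) :=
    (𝔖.map_ncspIso ψ hI hc hP 𝔭 𝔮 h𝔭 h𝔮 a).symm
  refine (hAdj _ _ h𝔭' h𝔮' hne' 1 one_pos a' ha').1.mpr fun c' hc' hlin => ?_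
  have hcc : ThetaFrobenioid.gpMap ψ.toMonoidHom (ThetaFrobenioid.gpMap ψ.symm.toMonoidHom c') = c' :=
    DivisorSupportData.gpMap_gpMap_symm ψ c'
  rw [← hcc] at hc' hlin ⊢
  change (suppOf' 𝔖.factor _).ncard = 4
  rw [𝔖.ncard_supp_gpMap ψ hI hP]
  refine H4 _ ((𝔖.isCuspidallyMinimal_gpMap_iff ψ hI hc hP _).mp hc') ?_
  have hab : Algebra.GrothendieckGroup.of (a' : 𝔉.PhiAcirc) *
      Algebra.GrothendieckGroup.of (𝔓.ncspIso _ _ h𝔭' h𝔮' a' : 𝔉.PhiAcirc) =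
      ThetaFrobenioid.gpMap ψ.toMonoidHom (Algebra.GrothendieckGroup.of (a : 𝔉.PhiAcirc) *
        Algebra.GrothendieckGroup.of (𝔓.ncspIso 𝔭 𝔮 h𝔭 h𝔮 a : 𝔉.PhiAcirc)) := by
    rw [map_mul, ThetaFrobenioid.gpMap_of, ThetaFrobenioid.gpMap_of, hb', Primes.coe_submonoidCongr_apply,
      MulEquiv.coe_toMonoidHom]
  rw [hab] at hlin
  exact (𝔖.linEquiv_gpMap_iff ψ hP _ _).mp hlin

/-- **Labels are transported affinely** (`label(ψ𝔭) = ε·label(𝔭) + c`, `ε = ±1`) by any monoid automorphism `ψ` of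
`Φ(A_⊚)` preserving cusps and principal elements, under the integral binder.
[cite: MochizukiEtTh2009, Prop 5.3 (v) p.325 (PDF p.99); proof p.327 (PDF p.101); §1 p.238–240 (PDF pp.12–14)] -/
theorem ncspLabels_affine_of_principalQ (𝔖 : DivisorSupportDataQ 𝔓) (hI : 𝔖.PrincipalIffIntegralDegreeZero)
    (hc : ∀ 𝔭, 𝔓.IsCuspidal (Primes.congr ψ 𝔭) ↔ 𝔓.IsCuspidal 𝔭)
    (hP : ∀ x, ThetaFrobenioid.gpMap ψ.toMonoidHom x ∈ 𝔖.principal ↔ x ∈ 𝔖.principal) :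
    ∃ (ε : ℤˣ) (c : ℤ), ∀ (p : Primes 𝔉.PhiAcirc) (hp : ¬ 𝔓.IsCuspidal p),
      𝔓.ncspEquivZ ⟨Primes.congr ψ p, fun h => hp ((hc p).mp h)⟩ = (ε : ℤ) * 𝔓.ncspEquivZ ⟨p, hp⟩ + c :=
  𝔓.ncspLabels_affine_of_adjacency ψ hc fun p q hp hq h =>
    𝔖.abs_sub_eq_one_congr_of_principalQ ψ hI hc hP p q hp hq h

/-- **The binder (hAut) as a THEOREM over `Q`**: every `g ∈ Aut_C(A_⊚)` preserving the cuspidal primes (`hAc`) and the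
principal elements (`hAP`) acts on the labels of the chain through `ℤ ⋊ {±1}`, under the integral binder.
[cite: MochizukiEtTh2009, §1 p.238–240 (PDF pp.12–14); Prop 5.3 (vi) p.326 (PDF p.100)] -/
theorem autChain_of_principalQ (𝔖 : DivisorSupportDataQ 𝔓) (hI : 𝔖.PrincipalIffIntegralDegreeZero)
    (hAc : ∀ (g : Aut 𝔉.Acirc) (𝔭 : Primes 𝔉.PhiAcirc),
      𝔓.IsCuspidal (Primes.congr (𝔉.pullAut g) 𝔭) ↔ 𝔓.IsCuspidal 𝔭)
    (hAP : ∀ (g : Aut 𝔉.Acirc) (x : Algebra.GrothendieckGroup 𝔉.PhiAcirc),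
      ThetaFrobenioid.gpMap (𝔉.pullAut g).toMonoidHom x ∈ 𝔖.principal ↔ x ∈ 𝔖.principal) :
    ∀ g : Aut 𝔉.Acirc, (∀ 𝔭, 𝔓.IsCuspidal (Primes.congr (𝔉.pullAut g) 𝔭) ↔ 𝔓.IsCuspidal 𝔭) ∧
      ∃ (ε : ℤˣ) (c : ℤ), ∀ (𝔭 : Primes 𝔉.PhiAcirc) (h𝔭 : ¬ 𝔓.IsCuspidal 𝔭)
        (h𝔭' : ¬ 𝔓.IsCuspidal (Primes.congr (𝔉.pullAut g) 𝔭)),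
        𝔓.ncspEquivZ ⟨Primes.congr (𝔉.pullAut g) 𝔭, h𝔭'⟩ = ε * 𝔓.ncspEquivZ ⟨𝔭, h𝔭⟩ + c := by
  intro g
  obtain ⟨ε, c, h⟩ := 𝔖.ncspLabels_affine_of_principalQ (𝔉.pullAut g) hI (hAc g) (hAP g)
  exact ⟨hAc g, ε, c, fun 𝔭 h𝔭 _ => h 𝔭 h𝔭⟩

/-! ### An element of `Φ(A_⊚)^gp` is determined by its orders; profiles -/

/-- Every element of a Grothendieck group is a fraction. [folklore] -/
private theorem exists_eq_of_div_of {M : Type*} [CommMonoid M] (z : Algebra.GrothendieckGroup M) :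
    ∃ a b : M, z = Algebra.GrothendieckGroup.of a / Algebra.GrothendieckGroup.of b := by
  induction z using Localization.induction_on with
  | H y =>
    refine ⟨y.1, y.2, eq_div_iff_mul_eq'.mpr ?_⟩
    rw [Localization.mk_eq_monoidOf_mk'_apply]
    exact Submonoid.LocalizationMap.mk'_spec _ _ _

/-- **`x ∈ Φ(A_⊚)^gp` is determined by its orders** (F2 injective, product-valued; port of L2-d4's `eq_of_ordGp_eq'`).
[cite: MochizukiEtTh2009, Prop 3.2 (i) p.296 (PDF p.70); Prop 5.3 proof p.326 (PDF p.100)] -/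
theorem eq_of_ordGp_eq (𝔖 : DivisorSupportDataQ 𝔓) {x y : Algebra.GrothendieckGroup 𝔉.PhiAcirc}
    (h : ∀ 𝔭, 𝔖.ordGp 𝔭 x = 𝔖.ordGp 𝔭 y) : x = y := by
  obtain ⟨a, b, rfl⟩ := exists_eq_of_div_of x
  obtain ⟨c, d, rfl⟩ := exists_eq_of_div_of y
  rw [div_eq_div_iff_mul_eq_mul, ← map_mul, ← map_mul]
  refine congrArg Algebra.GrothendieckGroup.of (𝔖.factor_injective (funext fun 𝔭 => ?_))
  have h𝔭 := h 𝔭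
  rw [map_div, map_div, ordGp_of, ordGp_of, ordGp_of, ordGp_of, div_eq_div_iff_mul_eq_mul] at h𝔭
  rw [map_mul, map_mul, Pi.mul_apply, Pi.mul_apply]
  exact h𝔭

/-- `x ∈ Φ(A_⊚)^gp` is determined by its (additive) orders. [cite: MochizukiEtTh2009, Prop 5.3 proof p.326 (PDF p.100)] -/
theorem eq_of_ord_eq (𝔖 : DivisorSupportDataQ 𝔓) {x y : Algebra.GrothendieckGroup 𝔉.PhiAcirc}
    (h : ∀ 𝔭, 𝔖.ord 𝔭 x = 𝔖.ord 𝔭 y) : x = y :=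
  𝔖.eq_of_ordGp_eq fun 𝔭 => Multiplicative.toAdd.injective (h 𝔭)

/-- F5 in additive form: `ord_𝔠(div Θ̈) = 1` at every cuspidal prime (Prop. 1.4 (i)).
[cite: MochizukiEtTh2009, Prop 1.4 (i) p.247 (PDF p.21); Prop 5.3 (vi) p.326 (PDF p.100)] -/
theorem ord_divTheta_cusp (𝔖 : DivisorSupportDataQ 𝔓) (𝔠 : Primes 𝔉.PhiAcirc) (h𝔠 : 𝔓.IsCuspidal 𝔠) :
    𝔖.ord 𝔠 𝔓.divTheta = 1 := by
  show Multiplicative.toAdd (ordGpOf' 𝔖.factor 𝔠 𝔓.divTheta) = 1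
  rw [𝔖.ordGp_divTheta_cusp 𝔠 h𝔠]
  rfl

/-- **Transport of profiles** along a monoid automorphism `φ` preserving cusps and principal elements and acting on the
labels by `j ↦ ε j + c` (port of L2-d4's `profile_gpMap'`; the order transport now rests on `map_gen_of_principal`).
[cite: MochizukiEtTh2009, Prop 5.3 proof p.327 (PDF p.101)] -/
theorem profile_gpMap (𝔖 : DivisorSupportDataQ 𝔓) (hI : 𝔖.PrincipalIffIntegralDegreeZero)
    (φ : 𝔉.PhiAcirc ≃* 𝔉.PhiAcirc)
    (hφc : ∀ 𝔭, 𝔓.IsCuspidal (Primes.congr φ 𝔭) ↔ 𝔓.IsCuspidal 𝔭)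
    (hφP : ∀ x, ThetaFrobenioid.gpMap φ.toMonoidHom x ∈ 𝔖.principal ↔ x ∈ 𝔖.principal) (ε : ℤˣ) (c : ℤ)
    (hφL : ∀ (𝔭 : Primes 𝔉.PhiAcirc) (h𝔭 : ¬ 𝔓.IsCuspidal 𝔭) (h𝔭' : ¬ 𝔓.IsCuspidal (Primes.congr φ 𝔭)),
      𝔓.ncspEquivZ ⟨Primes.congr φ 𝔭, h𝔭'⟩ = ε * 𝔓.ncspEquivZ ⟨𝔭, h𝔭⟩ + c)
    (θ : ℤ → ℚ) (s : ℤ) (hθ : ∀ j, θ (s - j) = θ j) (x : Algebra.GrothendieckGroup 𝔉.PhiAcirc) (t : ℤ)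
    (hx₁ : ∀ 𝔠, 𝔓.IsCuspidal 𝔠 → 𝔖.ord 𝔠 x = 1)
    (hx₂ : ∀ (𝔫 : Primes 𝔉.PhiAcirc) (h𝔫 : ¬ 𝔓.IsCuspidal 𝔫),
      𝔖.ord 𝔫 x = θ (𝔓.ncspEquivZ ⟨𝔫, h𝔫⟩ - t)) :
    (∀ 𝔠, 𝔓.IsCuspidal 𝔠 → 𝔖.ord 𝔠 (ThetaFrobenioid.gpMap (φ : 𝔉.PhiAcirc →* 𝔉.PhiAcirc) x) = 1) ∧
      ∀ (𝔫 : Primes 𝔉.PhiAcirc) (h𝔫 : ¬ 𝔓.IsCuspidal 𝔫),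
        𝔖.ord 𝔫 (ThetaFrobenioid.gpMap (φ : 𝔉.PhiAcirc →* 𝔉.PhiAcirc) x) =
          θ (𝔓.ncspEquivZ ⟨𝔫, h𝔫⟩ - (if ε = 1 then c + t else c - t - s)) := by
  have hc' := 𝔓.isCuspidal_congr_symm_iff φ hφc
  have hL' := 𝔓.ncspEquivZ_congr_symm φ ε c hφL
  rw [← MulEquiv.toMonoidHom_eq_coe]
  refine ⟨fun 𝔠 h𝔠 => ?_, fun 𝔫 h𝔫 => ?_⟩
  · rw [𝔖.ord_gpMap φ hI hφP]
    exact hx₁ _ ((hc' 𝔠).mpr h𝔠)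
  · rw [𝔖.ord_gpMap φ hI hφP, hx₂ _ ((hc' 𝔫).not.mpr h𝔫), hL' 𝔫 h𝔫 ((hc' 𝔫).not.mpr h𝔫)]
    rcases Int.units_eq_one_or ε with rfl | rfl
    · rw [if_pos rfl, Units.val_one]
      congr 1; ring
    · rw [if_neg (by decide), Units.val_neg, Units.val_one, ← hθ]
      congr 1; ring

/-- **The `Aut_C(A_⊚)`-orbit of `div(Θ̈)` is the set of elements with cuspidal orders `1` and non-cuspidal orders a
translate of the profile `θ`** (given `hdiv`, cusp-Aut, F1-Aut, `hInt`, F5, F6 and the injectivity of F2).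
[cite: MochizukiEtTh2009, Prop 5.3 (vi) p.326 (PDF p.100); proof p.327 (PDF p.101)] -/
theorem mem_thetaOrbit_iff_profile (𝔖 : DivisorSupportDataQ 𝔓) (hI : 𝔖.PrincipalIffIntegralDegreeZero)
    (θ : ℤ → ℚ) (s : ℤ) (hθ : ∀ j, θ (s - j) = θ j)
    (hdiv : ∀ (𝔫 : Primes 𝔉.PhiAcirc) (h𝔫 : ¬ 𝔓.IsCuspidal 𝔫),
      𝔖.ord 𝔫 𝔓.divTheta = θ (𝔓.ncspEquivZ ⟨𝔫, h𝔫⟩))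
    (hAc : ∀ (g : Aut 𝔉.Acirc) (𝔭 : Primes 𝔉.PhiAcirc),
      𝔓.IsCuspidal (Primes.congr (𝔉.pullAut g) 𝔭) ↔ 𝔓.IsCuspidal 𝔭)
    (hAP : ∀ (g : Aut 𝔉.Acirc) (x : Algebra.GrothendieckGroup 𝔉.PhiAcirc),
      ThetaFrobenioid.gpMap (𝔉.pullAut g).toMonoidHom x ∈ 𝔖.principal ↔ x ∈ 𝔖.principal)
    (x : Algebra.GrothendieckGroup 𝔉.PhiAcirc) :
    x ∈ Set.range (fun g : Aut 𝔉.Acirc =>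
        ThetaFrobenioid.gpMap (𝔉.pullAut g : 𝔉.PhiAcirc →* 𝔉.PhiAcirc) 𝔓.divTheta) ↔
      ∃ t : ℤ, (∀ 𝔠, 𝔓.IsCuspidal 𝔠 → 𝔖.ord 𝔠 x = 1) ∧
        ∀ (𝔫 : Primes 𝔉.PhiAcirc) (h𝔫 : ¬ 𝔓.IsCuspidal 𝔫), 𝔖.ord 𝔫 x = θ (𝔓.ncspEquivZ ⟨𝔫, h𝔫⟩ - t) := by
  have h0 : ∀ (𝔫 : Primes 𝔉.PhiAcirc) (h𝔫 : ¬ 𝔓.IsCuspidal 𝔫),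
      𝔖.ord 𝔫 𝔓.divTheta = θ (𝔓.ncspEquivZ ⟨𝔫, h𝔫⟩ - 0) := fun 𝔫 h𝔫 => by
    rw [sub_zero]; exact hdiv 𝔫 h𝔫
  have hAut := 𝔖.autChain_of_principalQ hI hAc hAP
  constructor
  · rintro ⟨g, rfl⟩
    obtain ⟨hgc, ε, c, hgL⟩ := hAut g
    exact ⟨_, 𝔖.profile_gpMap hI (𝔉.pullAut g) hgc (hAP g) ε c hgL θ s hθ 𝔓.divTheta 0 (𝔖.ord_divTheta_cusp) h0⟩
  · rintro ⟨t, h₁, h₂⟩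
    obtain ⟨g, hgc, hgL⟩ := 𝔖.exists_translate t
    have hgL' : ∀ (𝔭 : Primes 𝔉.PhiAcirc) (h𝔭 : ¬ 𝔓.IsCuspidal 𝔭)
        (h𝔭' : ¬ 𝔓.IsCuspidal (Primes.congr (𝔉.pullAut g) 𝔭)),
        𝔓.ncspEquivZ ⟨Primes.congr (𝔉.pullAut g) 𝔭, h𝔭'⟩ = ((1 : ℤˣ) : ℤ) * 𝔓.ncspEquivZ ⟨𝔭, h𝔭⟩ + t :=
      fun 𝔭 h𝔭 h𝔭' => by rw [Units.val_one, one_mul]; exact hgL 𝔭 h𝔭 h𝔭'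
    obtain ⟨k₁, k₂⟩ :=
      𝔖.profile_gpMap hI (𝔉.pullAut g) hgc (hAP g) 1 t hgL' θ s hθ 𝔓.divTheta 0 (𝔖.ord_divTheta_cusp) h0
    refine ⟨g, (𝔖.eq_of_ord_eq fun 𝔭 => ?_)⟩
    by_cases h𝔭 : 𝔓.IsCuspidal 𝔭
    · rw [k₁ 𝔭 h𝔭, h₁ 𝔭 h𝔭]
    · rw [k₂ 𝔭 h𝔭, h₂ 𝔭 h𝔭, if_pos rfl, add_zero]

/-! ### Proposition 5.3 (ii)–(vi) for `Ψ^Φ_{A_⊚}`, and the six-part assembly -/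

section Prop53

variable (Ψ : C ≌ C) (ι : Ψ.functor.obj 𝔉.Acirc ≅ 𝔉.Acirc)
  (e : 𝔉.PhiAcirc ≃* 𝔉.pre.Mon (𝔉.base.obj (Ψ.functor.obj 𝔉.Acirc)))

/-- **[EtTh] Proposition 5.3 (ii) over PERFECT `Φ(A_⊚)`** — a NON-VACUOUS instance form: `Ψ^Φ_{A_⊚}` is compatible with
the natural isomorphisms between non-cuspidal primary components, given (i) on primes, F1-Ψ and `hInt`.
[cite: MochizukiEtTh2009, Prop 5.3 (ii) p.325 (PDF p.99); Rmk 3.8.2] -/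
theorem preservesNcspComponentIsos_of_principalQ (𝔖 : DivisorSupportDataQ 𝔓) (hI : 𝔖.PrincipalIffIntegralDegreeZero)
    (hc : CuspPreserved 𝔓 Ψ ι e)
    (hP : ∀ x, ThetaFrobenioid.gpMap (psiPhi 𝔉 Ψ ι e).toMonoidHom x ∈ 𝔖.principal ↔ x ∈ 𝔖.principal) :
    PreservesNcspComponentIsos 𝔓 Ψ ι e hc :=
  fun p q hp hq _ x => 𝔖.map_ncspIso (psiPhi 𝔉 Ψ ι e) hI hc hP p q hp hq x

/-- **[EtTh] Proposition 5.3 (iii) over PERFECT `Φ(A_⊚)`** — a NON-VACUOUS instance form, for the cuspidal primary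
components.  [cite: MochizukiEtTh2009, Prop 5.3 (iii) p.325 (PDF p.99)] -/
theorem preservesCspComponentIsos_of_principalQ (𝔖 : DivisorSupportDataQ 𝔓) (hI : 𝔖.PrincipalIffIntegralDegreeZero)
    (hc : CuspPreserved 𝔓 Ψ ι e)
    (hP : ∀ x, ThetaFrobenioid.gpMap (psiPhi 𝔉 Ψ ι e).toMonoidHom x ∈ 𝔖.principal ↔ x ∈ 𝔖.principal) :
    PreservesCspComponentIsos 𝔓 Ψ ι e hc :=
  fun p q hp hq _ x => 𝔖.map_cspIso (psiPhi 𝔉 Ψ ι e) hI hc hP p q hp hq x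

/-- **[EtTh] Proposition 5.3 (iv) over PERFECT `Φ(A_⊚)`**: `Ψ^Φ_{A_⊚}` preserves the surjection
`Prime^csp ↠ Prime^ncsp`, given (i) on primes, F1-Ψ and `hInt` (port of L2-d4's `preservesCspToNcsp_of_criterion'`
with the criteria of (iv) supplied).  [cite: MochizukiEtTh2009, Prop 5.3 (iv) p.325 (PDF p.99); proof p.326 (PDF p.100)] -/
theorem preservesCspToNcsp_of_principalQ (𝔖 : DivisorSupportDataQ 𝔓) (hI : 𝔖.PrincipalIffIntegralDegreeZero)
    (hc : CuspPreserved 𝔓 Ψ ι e)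
    (hP : ∀ x, ThetaFrobenioid.gpMap (psiPhi 𝔉 Ψ ι e).toMonoidHom x ∈ 𝔖.principal ↔ x ∈ 𝔖.principal) :
    PreservesCspToNcsp 𝔓 Ψ ι e hc := by
  intro 𝔞 h𝔞
  set ψ := psiPhi 𝔉 Ψ ι e with hψ
  have hW := 𝔖.cspToNcspWitnessedQ_of_principalIffIntegralDegreeZero hI
  have hCrit := 𝔖.cspToNcspCriterionQ_of_degree fun x hx => ((hI x).mp hx).2
  obtain ⟨𝔫, h𝔫, a, b, n, ha, hn, hbc, hab, hmin, hlin⟩ := hW 𝔞 h𝔞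
  have h0 : 𝔓.cspToNcsp ⟨𝔞, h𝔞⟩ = ⟨𝔫, h𝔫⟩ := hCrit 𝔞 𝔫 h𝔞 h𝔫 a b n ha hn hbc hab hmin hlin
  have h𝔞' : 𝔓.IsCuspidal (Primes.congr ψ 𝔞) := (hc 𝔞).mpr h𝔞
  have h𝔫' : ¬ 𝔓.IsCuspidal (Primes.congr ψ 𝔫) := fun h => h𝔫 ((hc 𝔫).mp h)
  have hg : ∀ x : 𝔉.PhiAcirc, Algebra.GrothendieckGroup.of (ψ x) =
      ThetaFrobenioid.gpMap ψ.toMonoidHom (Algebra.GrothendieckGroup.of x) := fun x => by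
    rw [ThetaFrobenioid.gpMap_of, MulEquiv.coe_toMonoidHom]
  have hgba : Algebra.GrothendieckGroup.of (ψ b) * (Algebra.GrothendieckGroup.of (ψ a))⁻¹ =
      ThetaFrobenioid.gpMap ψ.toMonoidHom
        (Algebra.GrothendieckGroup.of b * (Algebra.GrothendieckGroup.of a)⁻¹) := by
    rw [map_mul, map_inv, hg a, hg b]
  have h1 : 𝔓.cspToNcsp ⟨Primes.congr ψ 𝔞, h𝔞'⟩ = ⟨Primes.congr ψ 𝔫, h𝔫'⟩ := by
    refine hCrit _ _ h𝔞' h𝔫' (ψ a) (ψ b) (ψ n) (DivisorSupportData.map_mem_carrier_congr ψ ha)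
      (DivisorSupportData.map_mem_carrier_congr ψ hn) ?_ ?_ ?_ ?_
    · change IsCuspidalGpOf' 𝔓 𝔖.factor _
      rw [hg b]; exact (𝔖.isCuspidalGp_gpMap_iff ψ hI hc hP _).mpr hbc
    · rw [hg a, hg b]; exact (𝔖.coprime_gpMap_iff ψ hI hP _ _).mpr hab
    · rw [hgba]; exact (𝔖.isCuspidallyMinimal_gpMap_iff ψ hI hc hP _).mpr hmin
    · rw [hgba, hg n]; exact (𝔖.linEquiv_gpMap_iff ψ hP _ _).mpr hlin
  have e1 : (𝔓.cspToNcsp ⟨Primes.congr ψ 𝔞, (hc 𝔞).mpr h𝔞⟩ : Primes 𝔉.PhiAcirc) = Primes.congr ψ 𝔫 :=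
    congrArg Subtype.val h1
  have e0 : (𝔓.cspToNcsp ⟨𝔞, h𝔞⟩ : Primes 𝔉.PhiAcirc) = 𝔫 := congrArg Subtype.val h0
  rw [e1, e0]

/-- **[EtTh] Proposition 5.3 (v) over PERFECT `Φ(A_⊚)`**: `Ψ^Φ_{A_⊚}` preserves the labels `Prime^ncsp ⥲ ℤ` up to `±1`
and translation, given (i) on primes, F1-Ψ and `hInt`.
[cite: MochizukiEtTh2009, Prop 5.3 (v) p.325 (PDF p.99); proof p.327 (PDF p.101)] -/
theorem preservesNcspLabels_of_principalQ (𝔖 : DivisorSupportDataQ 𝔓) (hI : 𝔖.PrincipalIffIntegralDegreeZero)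
    (hc : CuspPreserved 𝔓 Ψ ι e)
    (hP : ∀ x, ThetaFrobenioid.gpMap (psiPhi 𝔉 Ψ ι e).toMonoidHom x ∈ 𝔖.principal ↔ x ∈ 𝔖.principal) :
    PreservesNcspLabels 𝔓 Ψ ι e hc :=
  preservesNcspLabels_of_adjacency 𝔓 Ψ ι e hc fun 𝔭 𝔮 h𝔭 h𝔮 h =>
    𝔖.abs_sub_eq_one_congr_of_principalQ (psiPhi 𝔉 Ψ ι e) hI hc hP 𝔭 𝔮 h𝔭 h𝔮 h

/-- **[EtTh] Proposition 5.3 (vi) over PERFECT `Φ(A_⊚)`**: `Ψ^Φ_{A_⊚}` preserves the `Aut_C(A_⊚)`-orbit of `div(Θ̈)`,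
given (i) on primes, F1-Ψ, F1-Aut, cusp-Aut, `hInt` and the profile of `div(Θ̈)` (`hdiv`, Prop. 1.4 (i)) — port of
L2-d4's `preservesThetaDivisorOrbit_of_profile'` with (v) and (hAut) supplied as theorems.
[cite: MochizukiEtTh2009, Prop 5.3 (vi) p.326 (PDF p.100); proof p.327 (PDF p.101); Prop 1.4 (i) p.247 (PDF p.21)] -/
theorem preservesThetaDivisorOrbit_of_principalQ (𝔖 : DivisorSupportDataQ 𝔓) (hI : 𝔖.PrincipalIffIntegralDegreeZero)
    (hc : CuspPreserved 𝔓 Ψ ι e)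
    (hP : ∀ x, ThetaFrobenioid.gpMap (psiPhi 𝔉 Ψ ι e).toMonoidHom x ∈ 𝔖.principal ↔ x ∈ 𝔖.principal)
    (θ : ℤ → ℚ) (s : ℤ) (hθ : ∀ j, θ (s - j) = θ j)
    (hdiv : ∀ (𝔫 : Primes 𝔉.PhiAcirc) (h𝔫 : ¬ 𝔓.IsCuspidal 𝔫),
      𝔖.ord 𝔫 𝔓.divTheta = θ (𝔓.ncspEquivZ ⟨𝔫, h𝔫⟩))
    (hAc : ∀ (g : Aut 𝔉.Acirc) (𝔭 : Primes 𝔉.PhiAcirc),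
      𝔓.IsCuspidal (Primes.congr (𝔉.pullAut g) 𝔭) ↔ 𝔓.IsCuspidal 𝔭)
    (hAP : ∀ (g : Aut 𝔉.Acirc) (x : Algebra.GrothendieckGroup 𝔉.PhiAcirc),
      ThetaFrobenioid.gpMap (𝔉.pullAut g).toMonoidHom x ∈ 𝔖.principal ↔ x ∈ 𝔖.principal) :
    PreservesThetaDivisorOrbit 𝔓 Ψ ι e := by
  obtain ⟨ε, c, hLab⟩ := 𝔖.preservesNcspLabels_of_principalQ Ψ ι e hI hc hP
  set ψ := psiPhi 𝔉 Ψ ι e with hψ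
  have hLab' : ∀ (𝔭 : Primes 𝔉.PhiAcirc) (h𝔭 : ¬ 𝔓.IsCuspidal 𝔭) (h𝔭' : ¬ 𝔓.IsCuspidal (Primes.congr ψ 𝔭)),
      𝔓.ncspEquivZ ⟨Primes.congr ψ 𝔭, h𝔭'⟩ = ε * 𝔓.ncspEquivZ ⟨𝔭, h𝔭⟩ + c := fun 𝔭 h𝔭 _ => hLab 𝔭 h𝔭
  have hc' := 𝔓.isCuspidal_congr_symm_iff ψ hc
  have hP' := 𝔖.principal_gpMap_symm_iff ψ hP
  have hL' := 𝔓.ncspEquivZ_congr_symm ψ ε c hLab'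
  show _ '' _ = _
  ext x
  constructor
  · rintro ⟨y, hy, rfl⟩
    rw [𝔖.mem_thetaOrbit_iff_profile hI θ s hθ hdiv hAc hAP] at hy
    obtain ⟨t, h₁, h₂⟩ := hy
    exact (𝔖.mem_thetaOrbit_iff_profile hI θ s hθ hdiv hAc hAP _).mpr
      ⟨_, 𝔖.profile_gpMap hI ψ hc hP ε c hLab' θ s hθ y t h₁ h₂⟩
  · intro hx
    rw [𝔖.mem_thetaOrbit_iff_profile hI θ s hθ hdiv hAc hAP] at hx
    obtain ⟨t, h₁, h₂⟩ := hx
    refine ⟨ThetaFrobenioid.gpMap (ψ.symm : 𝔉.PhiAcirc →* 𝔉.PhiAcirc) x,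
      (𝔖.mem_thetaOrbit_iff_profile hI θ s hθ hdiv hAc hAP _).mpr
        ⟨_, 𝔖.profile_gpMap hI ψ.symm hc' hP' ε (-(ε * c)) hL' θ s hθ x t h₁ h₂⟩, ?_⟩
    rw [← MulEquiv.toMonoidHom_eq_coe, ← MulEquiv.toMonoidHom_eq_coe]
    exact DivisorSupportData.gpMap_gpMap_symm ψ x

/-- **[EtTh] Proposition 5.3 (i)–(vi) over PERFECT `Φ(A_⊚)`, from the intersection theory of the chain**: all six parts
(`GeometryOfDivisorsPreserved`) MODULO {`hind` (the `Ψ`-induced isomorphism of divisor monoids, [FrdI] Thm. 4.9), (i) as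
typed (Cor. 3.8 (iii)), F1-Ψ (`hP`), F1-Aut (`hAP`), cusp-Aut (`hAc`), the integral intersection-theory binder `hInt`
([EtTh] §1 p.240) and the profile of `div(Θ̈)` (`hdiv`, Prop. 1.4 (i))} — NON-VACUOUS at Prop. 5.1's perfect divisor
monoid (no `ℤ_{≥0}`-line hypothesis anywhere).
[cite: MochizukiEtTh2009, Prop 5.3 p.325–326 (PDF pp.99–100); proof p.326–327 (PDF pp.100–101); §1 p.240 (PDF p.14); Prop 1.4 (i) p.247 (PDF p.21)] -/
theorem geometryOfDivisorsPreserved_of_principalQ (𝔖 : DivisorSupportDataQ 𝔓) (T : DivisorTransportStub 𝔉)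
    (hind : T.IsInducedBy Ψ 𝔉.Acirc e) (hi : PreservesCuspidality T 𝔓 Ψ ι e)
    (hP : ∀ x, ThetaFrobenioid.gpMap (psiPhi 𝔉 Ψ ι e).toMonoidHom x ∈ 𝔖.principal ↔ x ∈ 𝔖.principal)
    (hI : 𝔖.PrincipalIffIntegralDegreeZero)
    (θ : ℤ → ℚ) (s : ℤ) (hθ : ∀ j, θ (s - j) = θ j)
    (hdiv : ∀ (𝔫 : Primes 𝔉.PhiAcirc) (h𝔫 : ¬ 𝔓.IsCuspidal 𝔫),
      𝔖.ord 𝔫 𝔓.divTheta = θ (𝔓.ncspEquivZ ⟨𝔫, h𝔫⟩))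
    (hAc : ∀ (g : Aut 𝔉.Acirc) (𝔭 : Primes 𝔉.PhiAcirc),
      𝔓.IsCuspidal (Primes.congr (𝔉.pullAut g) 𝔭) ↔ 𝔓.IsCuspidal 𝔭)
    (hAP : ∀ (g : Aut 𝔉.Acirc) (x : Algebra.GrothendieckGroup 𝔉.PhiAcirc),
      ThetaFrobenioid.gpMap (𝔉.pullAut g).toMonoidHom x ∈ 𝔖.principal ↔ x ∈ 𝔖.principal) :
    GeometryOfDivisorsPreserved T 𝔓 Ψ ι e := by
  obtain ⟨h₁, h₂, hc⟩ := hi hind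
  exact
    { induced := hind
      elements := ⟨h₁, h₂⟩
      primes := hc
      ncspIsos := 𝔖.preservesNcspComponentIsos_of_principalQ Ψ ι e hI hc hP
      cspIsos := 𝔖.preservesCspComponentIsos_of_principalQ Ψ ι e hI hc hP
      cspToNcsp := 𝔖.preservesCspToNcsp_of_principalQ Ψ ι e hI hc hP
      labels := 𝔖.preservesNcspLabels_of_principalQ Ψ ι e hI hc hP
      thetaOrbit := 𝔖.preservesThetaDivisorOrbit_of_principalQ Ψ ι e hI hc hP θ s hθ hdiv hAc hAP }

end Prop53

end DivisorSupportDataQ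

end FrobenioidThetaDivisors

end Literature.AnabelianGeometry.EtaleTheta
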